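import Summits.AtomisticToContinuum.HydrodynamicLimit.Theorems.CollisionIsometryCLTAdaptedWeightCLTSustainedAnisotropy

/-!
# Vocabulary of the line `sustained-anisotropy-superexp`, part B: the reshaped window stub
(crux `AdaptedWeightCLT`, stmt-AtomisticToContinuum-14868, rev-12 TIME-LOCAL form; route `CollisionIsometryCLT`,
sub-problem `HydrodynamicLimit`; line lead `prover-line-stmt-AtomisticToContinuum-14868-a1-0`)

Definitions-only support file (`--supports stmt-AtomisticToContinuum-14868`). The lead RESHAPES the registered stub
`stub_window` (from kinetic windows to the horizon; M, measure theory) into two registered stubs with disjoint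
technology, so that two workers can run in parallel:

* `CellUIStub` — the UNIFORM-INTEGRABILITY INPUT, a purely static statement about one configuration in the
  hard-sphere domain: `∫ₓ cellA(z, x) dx ≤ K₁ · (N+1)⁻¹ Σ_j (1 + |v_j|⁶)` for `N ≥ N₀` (`CellUIBound`). Content:
  Cauchy–Schwarz in the block sums, the hard-core DENSITY CAP of the block kernel (`ContactBalance.TimeZero.density_cap`:
  `(N+1)⁻¹ Σ_i φ_N(x_i − x) ≤ 27C/σ³`), `∫ₓ φ_N(x_i − x) dx = 1`, and the COVERING BOUND for the cell velocities
  `(N+1)⁻¹ Σ_i |cvel_i|ᵖ ≤ K'' (N+1)⁻¹ Σ_j |v_j|ᵖ` (Jensen on the cell averages; the column sums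
  `Σ_i ψ_N(x_j − x_i)/Σ_k ψ_N(x_k − x_i)` are bounded by a packing constant times `Cψ/cψ`, using the core clause of
  `CellKernel` and the hard-core packing lemma `PastDamping.sum_kernel_le`).
* `WindowOfUIStub` — the registered `WindowStub` with `CellUIBound φ ψ σ` as an extra hypothesis (window Fubini,
  Markov in the window end on H2, Markov on H1 + dominated convergence, Tonelli in `(t', z)`).

`windowStub_of : CellUIStub → WindowOfUIStub → WindowStub` is the (one-line) glue; the skeleton's `stub_window` is
now PROVED from `stub_cellUI` and `stub_windowOfUI`. Nothing is asserted: every `def … : Prop` is a predicate.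
-/

namespace Summit.AtomisticToContinuum.HydrodynamicLimit.Theorems.SustainedAnisotropy

open scoped BigOperators Topology Classical MeasureTheory ENNReal InnerProductSpace
open Filter Set MeasureTheory
open Literature.Analysis.FluidPDE
open Summit.AtomisticToContinuum.HydrodynamicLimit.Theorems.ContactSourceDuhamel
open Summit.AtomisticToContinuum.HydrodynamicLimit.Theorems.ContactSourceDuhamel.TimeLocal
open Summit.AtomisticToContinuum.HydrodynamicLimit.Theorems.ContactBalance
open Literature.MathematicalPhysics.KineticTheory (hsDiameter localGibbsLaw empiricalDensityField
  empiricalMomentumField)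

noncomputable section

/-! ## The uniform-integrability bound of the cell anisotropy -/

/-- UNIFORM-INTEGRABILITY BOUND for the block kernel family `φ`, the cell kernel family `ψ` and the reduced diameter
`σ`: there are `K₁` and `N₀` such that for `N ≥ N₀` and every configuration `z` in the hard-sphere domain of diameter
`hsDiameter σ N`, `∫ₓ cellA(z, x) dx ≤ K₁ · (N+1)⁻¹ Σ_j (1 + |v_j|⁶)` (the sixth velocity moment of the empirical
measure controls the space integral of the kinetic cell anisotropy; `|v|⁴ ≤ 1 + |v|⁶`). -/
def CellUIBound (φ ψ : ℕ → T3 → ℝ) (σ : ℝ) : Prop :=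
  ∃ K₁ : ℝ, ∃ N₀ : ℕ, ∀ N : ℕ, N₀ ≤ N →
    ∀ z ∈ hardSphereDomain (Torus.geometry (Fin 3)) (N + 1) (hsDiameter σ N),
      ∫ x, cellA N φ ψ z x ≤ K₁ * (((N + 1 : ℕ) : ℝ)⁻¹ * ∑ j : Fin (N + 1), (1 + ‖(z j).2‖ ^ 6))

/-- Statement of STUB 4a (the UI input): every admissible block kernel family, every cell kernel family and every
`0 < σ < 1/2` satisfy `CellUIBound`. -/
def CellUIStub : Prop := ∀ (γ C : ℝ) (φ : ℕ → T3 → ℝ), 0 < γ → γ ≤ 1 / 15 → AdmissibleKernel γ C φ →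
  ∀ (ψ : ℕ → T3 → ℝ) (ℓ : ℕ → ℝ), CellKernel ψ ℓ → ∀ σ : ℝ, 0 < σ → σ < 2⁻¹ → CellUIBound φ ψ σ

/-- Statement of STUB 4b (from kinetic windows to the horizon, GIVEN the UI bound): the registered `WindowStub` with
`CellUIBound φ ψ σ` inserted after the cell-kernel hypothesis. -/
def WindowOfUIStub : Prop := ∀ (a₀ θ₀ : T3 → ℝ) (u₀ : T3 → V3), NiceProfiles a₀ θ₀ u₀ →
  ∀ σ : ℝ, 0 < σ → σ < 2⁻¹ → ∀ Φ : Flows σ, DiffuseAt σ a₀ θ₀ u₀ Φ →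
    ∀ (γ C : ℝ) (φ : ℕ → T3 → ℝ), 0 < γ → γ ≤ 1 / 15 → AdmissibleKernel γ C φ →
      ∀ (ψ : ℕ → T3 → ℝ) (ℓ : ℕ → ℝ), CellKernel ψ ℓ → CellUIBound φ ψ σ → ∀ Δ : ℕ → ℝ, Window Δ →
        ∀ t : ℝ, 0 < t → TailsOn σ a₀ θ₀ u₀ Φ t →
          (∀ (a lam Cw : ℝ), 0 < a → 0 < lam → 0 < Cw → ∃ ε : ℝ, 0 < ε ∧ ∀ η : ℝ, 0 < η →
              ∀ᶠ N : ℕ in atTop, ∀ t' : ℝ, Δ N ≤ t' →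
                localGibbsLaw σ a₀ u₀ θ₀ N (Φ N) (susEvent σ N (Φ N) φ ψ (Δ N) a ε lam Cw t') ≤ ENNReal.ofReal η) →
            ∀ κ : ℝ, 0 < κ →
              Tendsto (fun N : ℕ => localGibbsLaw σ a₀ u₀ θ₀ N (Φ N) {z | κ < CellInt σ N (Φ N) φ ψ t z}) atTop (𝓝 0)

/-- The glue of the reshaping: the UI input and the conditioned window statement give the registered `WindowStub`. -/
theorem windowStub_of (hUI : CellUIStub) (hW : WindowOfUIStub) : WindowStub :=
  fun a₀ θ₀ u₀ hnice σ hσ hσ2 Φ hD γ C φ hγ hγ' hadm ψ ℓ hcell Δ hwin t ht hT hsmall κ hκ =>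
    hW a₀ θ₀ u₀ hnice σ hσ hσ2 Φ hD γ C φ hγ hγ' hadm ψ ℓ hcell (hUI γ C φ hγ hγ' hadm ψ ℓ hcell σ hσ hσ2)
      Δ hwin t ht hT hsmall κ hκ

/-! ## Anchor (registered stub `sa_vocabularyB_anchor`) -/

/-- Anchor of part B of the vocabulary: the UI bound at `N` gives it at every larger threshold. -/
theorem sa_vocabularyB_anchor : ∀ (φ ψ : ℕ → T3 → ℝ) (σ : ℝ), CellUIBound φ ψ σ →
    ∃ K₁ : ℝ, ∃ N₀ : ℕ, ∀ N : ℕ, N₀ ≤ N →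
      ∀ z ∈ hardSphereDomain (Torus.geometry (Fin 3)) (N + 1) (hsDiameter σ N),
        ∫ x, cellA N φ ψ z x ≤ K₁ * (((N + 1 : ℕ) : ℝ)⁻¹ * ∑ j : Fin (N + 1), (1 + ‖(z j).2‖ ^ 6)) :=
  fun _ _ _ h => h

end

end Summit.AtomisticToContinuum.HydrodynamicLimit.Theorems.SustainedAnisotropy
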